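import Mathlib
import Literature.Computability.AlgebraicComplexity.ApolarityAction
import Literature.Computability.AlgebraicComplexity.PaddedPermanentPartials

/-!
# Four-row pencil transfer `m → m + 1` — preliminaries (wall-breaker axis k8, crux `ValuativeFlip`)

Support lemmas for line `four-row-count` of crux `ValuativeGCT.ValuativeFlip`
(stmt-ValiantsHypothesis-12624), stub `stub_fourRowPencilRank`, used by the transfer theorem of
`ValuativeGCTValuativeFlipPencilTransferCore.lean`: a block extension of an invertible
substitution along an injective renaming, the elementary transvection substitution, the inverse
chain rule for the restricted tangent span, small polynomial identities, and the existence of a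
column with nonzero kept part.  No definitions are introduced.
-/

set_option linter.dupNamespace false

namespace Summit.ValiantsHypothesis.ValiantsHypothesis.Theorems.ValuativeFlip

open MvPolynomial
open scoped BigOperators Matrix
open Literature.Computability.AlgebraicComplexity

noncomputable section

/-! ## Block extension of an invertible substitution along an injective renaming -/

/-- **Block extension.** For an injective renaming `j : σ → τ` and `g ∈ GL_σ`, there is
`g' ∈ GL_τ` acting as `g` (transported along `j`) on the variables `X (j i)` and fixing every
variable outside the range of `j`: the block matrix `g ⊕ 1` re-indexed along `j`. [folklore] -/
theorem pt_exists_blockExt {σ τ : Type*} [Fintype σ] [DecidableEq σ] [Fintype τ] [DecidableEq τ]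
    (j : σ → τ) (hj : Function.Injective j) (g : GL σ ℂ) :
    ∃ g' : GL τ ℂ,
      (∀ i, linSubst τ ℂ (g' : Matrix τ τ ℂ) (X (j i)) =
          rename j (linSubst σ ℂ (g : Matrix σ σ ℂ) (X i))) ∧
      (∀ t, t ∉ Set.range j → linSubst τ ℂ (g' : Matrix τ τ ℂ) (X t) = X t) := by
  classical
  let E : σ ⊕ ((Set.range j)ᶜ : Set τ) ≃ τ :=
    (Equiv.sumCongr (Equiv.ofInjective j hj) (Equiv.refl _)).trans (Equiv.Set.sumCompl (Set.range j))
  let M : Matrix (σ ⊕ ((Set.range j)ᶜ : Set τ)) (σ ⊕ ((Set.range j)ᶜ : Set τ)) ℂ :=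
    Matrix.fromBlocks (g : Matrix σ σ ℂ) 0 0 1
  let A : Matrix τ τ ℂ := Matrix.reindex E E M
  have hEl : ∀ i, E (Sum.inl i) = j i := fun i => by simp [E]
  have hEr : ∀ c : ((Set.range j)ᶜ : Set τ), E (Sum.inr c) = (c : τ) := fun c => by simp [E]
  have hdet : A.det ≠ 0 := by
    rw [Matrix.det_reindex_self, Matrix.det_fromBlocks_zero₂₁, Matrix.det_one, mul_one]
    exact Matrix.GeneralLinearGroup.det_ne_zero g
  have hcol : ∀ s : σ ⊕ ((Set.range j)ᶜ : Set τ), linSubst τ ℂ A (X (E s)) =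
      ∑ s' : σ ⊕ ((Set.range j)ᶜ : Set τ), M s' s • (X (E s') : MvPolynomial τ ℂ) := by
    intro s
    rw [linSubst_X, ← Equiv.sum_comp E]
    refine Finset.sum_congr rfl fun s' _ => ?_
    simp [A, Matrix.reindex_apply, Matrix.submatrix_apply]
  refine ⟨Matrix.GeneralLinearGroup.mkOfDetNeZero A hdet, fun i => ?_, fun t ht => ?_⟩
  · rw [Matrix.GeneralLinearGroup.val_mkOfDetNeZero, ← hEl, hcol, Fintype.sum_sum_type,
      linSubst_X, map_sum]
    simp [M, hEl, Matrix.fromBlocks_apply₁₁, Matrix.fromBlocks_apply₂₁, rename_X]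
  · have htc : t ∈ (Set.range j)ᶜ := ht
    have h1 := hcol (Sum.inr ⟨t, htc⟩)
    rw [hEr] at h1
    rw [Matrix.GeneralLinearGroup.val_mkOfDetNeZero]
    refine h1.trans ?_
    rw [Fintype.sum_sum_type]
    simp only [M, Matrix.fromBlocks_apply₁₂, Matrix.zero_apply, zero_smul, Finset.sum_const_zero,
      zero_add, Matrix.fromBlocks_apply₂₂, Matrix.one_apply, ite_smul, one_smul, zero_smul,
      Finset.sum_ite_eq', Finset.mem_univ, if_true, hEr]

/-! ## The elementary transvection substitution -/

/-- The transvection `1 + E_{c l}` (`c ≠ l`, unimodular) acts on variables by `X l ↦ X l + X c`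
and fixes every other variable. [folklore] -/
theorem pt_exists_transvection {τ : Type*} [Fintype τ] [DecidableEq τ] (c l : τ) (hcl : c ≠ l) :
    ∃ T : GL τ ℂ, (∀ i, i ≠ l → linSubst τ ℂ (T : Matrix τ τ ℂ) (X i) = X i) ∧
      linSubst τ ℂ (T : Matrix τ τ ℂ) (X l) = X l + X c := by
  classical
  have hdet : (Matrix.transvection c l (1 : ℂ)).det ≠ 0 := by
    rw [Matrix.det_transvection_of_ne c l hcl]; exact one_ne_zero
  refine ⟨Matrix.GeneralLinearGroup.mkOfDetNeZero _ hdet, fun i hi => ?_, ?_⟩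
  · rw [Matrix.GeneralLinearGroup.val_mkOfDetNeZero, linSubst_X]
    simp only [Matrix.transvection, Matrix.add_apply, Matrix.one_apply, add_smul, ite_smul,
      one_smul, zero_smul, Finset.sum_add_distrib, Finset.sum_ite_eq', Finset.mem_univ, if_true]
    rw [Finset.sum_eq_zero, add_zero]
    intro x _
    rw [Matrix.single_apply_of_ne, zero_smul]
    exact fun h => hi h.2.symm
  · rw [Matrix.GeneralLinearGroup.val_mkOfDetNeZero, linSubst_X]
    simp only [Matrix.transvection, Matrix.add_apply, Matrix.one_apply, add_smul, ite_smul,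
      one_smul, zero_smul, Finset.sum_add_distrib, Finset.sum_ite_eq', Finset.mem_univ, if_true]
    congr 1
    rw [Finset.sum_eq_single c]
    · rw [Matrix.single_apply_same, one_smul]
    · intro x _ hx
      rw [Matrix.single_apply_of_ne, zero_smul]
      exact fun h => hx h.1.symm
    · intro h; exact absurd (Finset.mem_univ c) h

/-! ## The inverse chain rule for the restricted tangent span -/

/-- **Inverse chain rule.** For `g` invertible, `g · (∂ᵢ f) = ∑_b (g⁻¹)ᵢ_b ∂_b (g · f)`, so every
`X a · ρ (g · ∂ᵢ f)` lies in the span of the `X a · ρ (∂_b (g · f))` (`ρ` any linear map).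
[folklore] -/
theorem pt_X_mul_linSubst_pderiv_mem_span {τ : Type*} [Fintype τ] [DecidableEq τ] {K : τ → Prop} (ρ : MvPolynomial τ ℂ →ₗ[ℂ] MvPolynomial τ ℂ)
    (g : GL τ ℂ) (f : MvPolynomial τ ℂ) (a : {a : τ // K a}) (i : τ) :
    X a.1 * ρ (linSubst τ ℂ (g : Matrix τ τ ℂ) (pderiv i f)) ∈
      Submodule.span ℂ (Set.range fun ab : {a : τ // K a} × τ =>
        X ab.1.1 * ρ (pderiv ab.2 (linSubst τ ℂ (g : Matrix τ τ ℂ) f))) := by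
  classical
  have key : linSubst τ ℂ (g : Matrix τ τ ℂ) (pderiv i f) =
      ∑ b, ((g⁻¹ : GL τ ℂ) : Matrix τ τ ℂ) i b • pderiv b (linSubst τ ℂ (g : Matrix τ τ ℂ) f) := by
    simp_rw [pderiv_linSubst_eq_sum, Finset.smul_sum, smul_smul]
    rw [Finset.sum_comm]
    simp_rw [← Finset.sum_smul, ← Matrix.mul_apply]
    rw [show ((g⁻¹ : GL τ ℂ) : Matrix τ τ ℂ) * (g : Matrix τ τ ℂ) = 1 from Units.inv_mul g]
    rw [Finset.sum_eq_single i]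
    · rw [Matrix.one_apply_eq, one_smul]
    · intro b _ hb; rw [Matrix.one_apply_ne' hb, zero_smul]
    · intro h; exact absurd (Finset.mem_univ i) h
  rw [key, map_sum, Finset.mul_sum]
  refine Submodule.sum_mem _ fun b _ => ?_
  rw [map_smul, mul_smul_comm]
  exact Submodule.smul_mem _ _ (Submodule.subset_span ⟨(a, b), rfl⟩)


/-! ## Small polynomial identities -/

/-- The partial derivatives of the linear form `A · X l = ∑_j A j l • X j` are the constants
`A b l`. [folklore] -/
theorem pt_pderiv_linSubst_X {τ : Type*} [Fintype τ] [DecidableEq τ] (A : Matrix τ τ ℂ) (b l : τ) :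
    pderiv b (linSubst τ ℂ A (X l)) = C (A b l) := by
  classical
  rw [linSubst_X, map_sum]
  simp only [Derivation.map_smul, pderiv_X, Pi.single_apply, smul_ite, smul_zero, Finset.sum_ite_eq',
    Finset.mem_univ, if_true]
  rw [MvPolynomial.smul_eq_C_mul, mul_one]

/-- A substitution fixing every variable of the range of a renaming fixes every renamed
polynomial. [folklore] -/
theorem pt_linSubst_rename_of_fix {τ : Type*} [Fintype τ] {α : Type*} (A : Matrix τ τ ℂ) (ψ : α → τ)
    (h : ∀ x, linSubst τ ℂ A (X (ψ x)) = X (ψ x)) (Q : MvPolynomial α ℂ) :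
    linSubst τ ℂ A (rename ψ Q) = rename ψ Q := by
  have hc : (linSubst τ ℂ A).comp (rename ψ) = rename ψ := by
    apply MvPolynomial.algHom_ext
    intro x
    rw [AlgHom.comp_apply, rename_X, h x]
  exact congrArg (fun F : MvPolynomial α ℂ →ₐ[ℂ] MvPolynomial τ ℂ => F Q) hc

/-- Transport of a substitution along a renaming: if `g'` acts on the variables `X (j i)` as `g`
does on `X i` (transported), then `g' · (rename j f) = rename j (g · f)`. [folklore] -/
theorem pt_linSubst_rename_of_forall {σ τ : Type*} [Fintype σ] [Fintype τ]
    {A : Matrix σ σ ℂ} {A' : Matrix τ τ ℂ} {j : σ → τ}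
    (h : ∀ i, linSubst τ ℂ A' (X (j i)) = rename j (linSubst σ ℂ A (X i))) (f : MvPolynomial σ ℂ) :
    linSubst τ ℂ A' (rename j f) = rename j (linSubst σ ℂ A f) := by
  have hc : (linSubst τ ℂ A').comp (rename j) = (rename j).comp (linSubst σ ℂ A) := by
    apply MvPolynomial.algHom_ext
    intro i
    rw [AlgHom.comp_apply, AlgHom.comp_apply, rename_X, h i]
  exact congrArg (fun F : MvPolynomial σ ℂ →ₐ[ℂ] MvPolynomial τ ℂ => F f) hc

/-! ## A column with nonzero kept part -/

/-- For an invertible matrix and a kept set with at least two elements, some column other than a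
prescribed one has a nonzero kept part (two rows of an invertible matrix cannot both be supported
on a single column). [folklore] -/
theorem pt_exists_col {τ : Type*} [Fintype τ] [DecidableEq τ] {K : τ → Prop} [DecidablePred K] (hK2 : ∃ a₁ a₂ : τ, K a₁ ∧ K a₂ ∧ a₁ ≠ a₂)
    (g : GL τ ℂ) (l : τ) :
    ∃ c, c ≠ l ∧ aeval (fun i : τ => if K i then (X i : MvPolynomial τ ℂ) else 0)
      (linSubst τ ℂ (g : Matrix τ τ ℂ) (X c)) ≠ 0 := by
  classical
  obtain ⟨a₁, a₂, ha₁, ha₂, hne⟩ := hK2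
  by_contra hcon
  have hcon' : ∀ c, c ≠ l → aeval (fun i : τ => if K i then (X i : MvPolynomial τ ℂ) else 0)
      (linSubst τ ℂ (g : Matrix τ τ ℂ) (X c)) = 0 := by
    intro c hc
    by_contra hne
    exact hcon ⟨c, hc, hne⟩
  have hzero : ∀ c, c ≠ l → ∀ i, K i → (g : Matrix τ τ ℂ) i c = 0 := by
    intro c hc i hi
    have h := congr_arg (eval fun t : τ => if t = i then (1 : ℂ) else 0) (hcon' c hc)
    rw [linSubst_X, map_sum, map_sum, map_zero, Finset.sum_eq_single i] at h
    · simpa [hi, MvPolynomial.smul_eval] using h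
    · intro x _ hx
      by_cases hKx : K x
      · simp [hKx, hx, MvPolynomial.smul_eval]
      · simp [hKx]
    · intro h
      exact absurd (Finset.mem_univ i) h
  have hE : ∀ a b, K a → (g : Matrix τ τ ℂ) a l * ((g⁻¹ : GL τ ℂ) : Matrix τ τ ℂ) l b =
      (1 : Matrix τ τ ℂ) a b := by
    intro a b ha
    have h := congr_fun (congr_fun
      (Units.mul_inv g : (g : Matrix τ τ ℂ) * ((g⁻¹ : GL τ ℂ) : Matrix τ τ ℂ) = 1) a) b
    rw [Matrix.mul_apply, Finset.sum_eq_single l] at h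
    · exact h
    · intro c _ hc
      rw [hzero c hc a ha, zero_mul]
    · intro h
      exact absurd (Finset.mem_univ l) h
  have h11 := hE a₁ a₁ ha₁
  have h22 := hE a₂ a₂ ha₂
  have h21 := hE a₂ a₁ ha₂
  rw [Matrix.one_apply_eq] at h11 h22
  rw [Matrix.one_apply_ne hne.symm] at h21
  rcases mul_eq_zero.mp h21 with h | h
  · rw [h, zero_mul] at h22
    exact zero_ne_one h22
  · rw [h, mul_zero] at h11
    exact zero_ne_one h11

end

end Summit.ValiantsHypothesis.ValiantsHypothesis.Theorems.ValuativeFlip
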